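import Literature.MathematicalPhysics.QuantumFieldTheory.ConformalBootstrap3D.PointKernelK34L505Data
import Literature.MathematicalPhysics.QuantumFieldTheory.ConformalBootstrap3D.PointKernelK34L505Segs

/-!
# K34L505 certificate, kernel block file H5: head segments (monotone coefficient rule; block checker `PCert.hBlockOK` of `PointKernel`, soundness `PCert.hBlockOK_sound`), segments `86 ≤ i < 132`

`decide` by kernel reduction (no `native_decide`, no extra axioms) on the literal data of
`PointKernelK34L505Data`, on the certificate itself (full `s`-width) or on its piece certificates
`pcP_i = certK34L505.withS σ_i σ_(i+1) …` (the cell numbers on an `s`-piece; assembled by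
`CellFactS_of_pieces`).  Estimated kernel time 258 s (6 theorems).
-/

set_option maxRecDepth 100000
set_option maxHeartbeats 0

namespace Literature.MathematicalPhysics.QuantumFieldTheory.ConformalBootstrap3D.PointKernelK34L505

open Literature.MathematicalPhysics.QuantumFieldTheory.ConformalBootstrap3D.PointKernel

/-- segments `[86, 93)` of `hsegsK34L505` pass the kernel evaluator (≈3 s of kernel work). [folklore] -/
theorem hBlock_86 : certK34L505.hBlockOK hsegsK34L505 86 93 JHK34L505 = true := by
  decide +kernel

/-- segment `[127, 128)` of `hsegsK34L505` passes the kernel evaluator (≈38 s of kernel work). [folklore] -/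
theorem hBlock_127 : certK34L505.hBlockOK hsegsK34L505 127 128 JHK34L505 = true := by
  decide +kernel

/-- segment `[128, 129)` of `hsegsK34L505` passes the kernel evaluator (≈37 s of kernel work). [folklore] -/
theorem hBlock_128 : certK34L505.hBlockOK hsegsK34L505 128 129 JHK34L505 = true := by
  decide +kernel

/-- segment `[129, 130)` of `hsegsK34L505` passes the kernel evaluator (≈37 s of kernel work). [folklore] -/
theorem hBlock_129 : certK34L505.hBlockOK hsegsK34L505 129 130 JHK34L505 = true := by
  decide +kernel

/-- segment `[130, 131)` of `hsegsK34L505` passes the kernel evaluator (≈37 s of kernel work). [folklore] -/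
theorem hBlock_130 : certK34L505.hBlockOK hsegsK34L505 130 131 JHK34L505 = true := by
  decide +kernel

/-- segment `[131, 132)` of `hsegsK34L505` passes the kernel evaluator (≈37 s of kernel work). [folklore] -/
theorem hBlock_131 : certK34L505.hBlockOK hsegsK34L505 131 132 JHK34L505 = true := by
  decide +kernel

end Literature.MathematicalPhysics.QuantumFieldTheory.ConformalBootstrap3D.PointKernelK34L505
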